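import Mathlib
import Summits.ValiantsHypothesis.ValiantsHypothesis.Theorems.LacunarySymmetroidMatrixDescartesTwoSidedLoewner

/-!
# `MatrixDescartes` (stmt-ValiantsHypothesis-18050) — THE FLAG BOUND: on the monotone sector, with NO invertibility anywhere,
# `Z₊(mult) + dim W_U + dim W_L ≤ m + ν(S₀|W_L) + π(S₀|W_U)` for the joint kernels `W_U`, `W_L` of the upper / lower letters

HONEST FRAMING.  Cell `pub-symmetroid`, seat `val-sym-mdr-p2` (gen 22); helper file `--supports` the crux
`Theses.LacunarySymmetroid.MatrixDescartes` (OPEN), NO closure claim.  A STRUCTURE LAW on the monotone sector beside the crux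
(the item «general flag, NOT filed» of the predecessor memo MONOTONE-EXACT.md §4 (L2), in a form that needs no flag): nothing
here bears on the crux in its window, `stub_twoSided`, `DoorA26` / `DoorA34`, registers, or `VP ≠ VNP`.

SETTING (crux currency, as in `…TwoSidedLoewner`).  Real symmetric letters `S l` (`l : κ`) of size `ι`, exponents `d l`, a pivot
index `l₀` with `S₀ := S l₀` ARBITRARY (singular allowed), and the MONOTONE SECTOR: every other letter is PSD with `d l > d l₀`
(an UPPER letter) or NSD with `d l < d l₀` (a LOWER letter); `det F ≢ 0` for `F(X) = Σ_l X^{d l} S l`.  A matrix `B_U : ι × α`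
with `S l · B_U = 0` for every upper letter and injective `B_U·` is a basis of a subspace of the JOINT KERNEL
`W_U = ⋂_{upper} ker S l`; likewise `B_L : ι × β` for the lower letters; `C_U = B_Uᵀ S₀ B_U`, `C_L = B_Lᵀ S₀ B_L` are the two
compressions of the pivot letter.

* `form_mulVec_eq` — `(Bc)ᵀ A (Bc) = cᵀ (BᵀAB) c`; `linearIndependent_mulVec_eigen` — `B` injective ⇒ the images of an
  eigenvector sub-family of `BᵀS₀B` are independent.
* **`negIndex_add_posIndex_compression_ge`** — at EVERY `x > 0` with `det F(x) ≠ 0`: `ν(F(x)) + π(C_U) ≥ card α`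
  (the images of the non-positive eigenvectors of `C_U` form a family on which `F(x) ⪯ 0`: upper letters vanish there, lower
  letters are NSD, the pivot is `≤ 0`; Sylvester in family language `Inertia.card_add_card_le'` against the positive eigen-family
  of `F(x)`, and `ν + π = card ι` at a non-singular point).
* **`negIndex_add_card_le_compression`** — at EVERY `x > 0`: `ν(F(x)) + card β ≤ card ι + ν(C_L)` (mirror: the images of the
  non-negative eigenvectors of `C_L` carry `F(x) ⪰ 0`).
* **`monotone_pencil_flag_bound` (THE FLAG BOUND).**  `Z₊(mult) + card α + card β ≤ card ι + ν(C_L) + π(C_U)`, i.e. with full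
  bases `Z₊(mult) ≤ m − ν̄(S₀|W_U) − π̄(S₀|W_L)` (`ν̄` / `π̄` = number of non-positive / non-negative eigenvalues of the
  compression): directions killed by all upper letters on which the pivot is `≤ 0` stay negative for ever, directions killed by all
  lower letters on which the pivot is `≥ 0` are non-negative from the start, and by the tree's window law
  (`GramDual.monotone_pencil_card_posRoots_multiset_eq_window`, positive type) the roots with multiplicity are EXACTLY the drop
  `ν(F(0⁺)) − ν(F(∞))`.  Distinct-root form `monotone_pencil_flag_bound_card`.
* `monotone_pencil_flag_bound_oneSided` — no lower letters (`B_L = 1`): `Z₊(mult) + card α ≤ ν(S₀) + π(C_U)`; this sharpens the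
  one-sided rung `Z₊ ≤ ν(S₀)` WITHOUT the tree's non-singularity hypotheses (`firstRung_exact` needs a non-singular top letter,
  `oneSided_pencil_card_posRoots_multiset_eq` needs `det S₀ ≠ 0`).
The bound CONTAINS the two-sided Loewner rung `Z₊(mult) ≤ m` (`ν(C_L) ≤ card β`, `π(C_U) ≤ card α`) and is an equality for full
bases of `W_U`, `W_L` (the FLAG FORM OF THE EXACT MONOTONE COUNT; separate file).  Sanity instances (paper): `m = 2`,
`S₀ = [[0,1],[1,0]]`, one upper letter `e₁e₁ᵀ`: `det F = −X^{2d₀}`, `Z₊ = 0`, and the bound reads `0 + 1 + 2 ≤ 2 + 1 + 0`;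
`S₀ = −1`, upper letter `1`: `Z₊ = 2` (double root), bound `2 + 0 + 2 ≤ 2 + 2 + 0`.

[folklore] (Sylvester's law of inertia in family language; Loewner monotonicity).  Axioms `propext`, `Classical.choice`,
`Quot.sound`.  No definitions.
-/

-- layout Summits/ValiantsHypothesis/ValiantsHypothesis forces the duplicated namespace component
set_option linter.dupNamespace false

namespace Summit.ValiantsHypothesis.ValiantsHypothesis.Theorems.LacunarySymmetroidMatrixDescartes

open Polynomial Matrix Finset
open scoped BigOperators

namespace GramDual

section Compressions

/-! ## §1 Compressions: forms and independence -/

/-- `(B c)ᵀ A (B c) = cᵀ (Bᵀ A B) c`. [folklore] -/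
theorem form_mulVec_eq {ι α : Type} [Fintype ι] [Fintype α] (A : Matrix ι ι ℝ) (B : Matrix ι α ℝ) (c : α → ℝ) :
    (B *ᵥ c) ⬝ᵥ (A *ᵥ (B *ᵥ c)) = c ⬝ᵥ ((Bᵀ * A * B) *ᵥ c) := by
  calc (B *ᵥ c) ⬝ᵥ (A *ᵥ (B *ᵥ c)) = (c ᵥ* Bᵀ) ⬝ᵥ (A *ᵥ (B *ᵥ c)) := by rw [Matrix.vecMul_transpose]
    _ = c ⬝ᵥ (Bᵀ *ᵥ (A *ᵥ (B *ᵥ c))) := (Matrix.dotProduct_mulVec _ _ _).symm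
    _ = c ⬝ᵥ ((Bᵀ * A * B) *ᵥ c) := by rw [Matrix.mulVec_mulVec, Matrix.mulVec_mulVec]

/-- A combination of images is the image of the combination. [folklore] -/
theorem sum_smul_mulVec {ι α γ : Type} [Fintype α] [Fintype γ] (B : Matrix ι α ℝ) (w : γ → α → ℝ) (c : γ → ℝ) :
    ∑ i, c i • (B *ᵥ w i) = B *ᵥ ∑ i, c i • w i := by
  rw [Matrix.mulVec_sum]
  exact Finset.sum_congr rfl fun i _ => by rw [Matrix.mulVec_smul]

/-- Real symmetric compressions are hermitian. [folklore] -/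
theorem isHermitian_compression {ι α : Type} [Fintype ι] [Fintype α] {A : Matrix ι ι ℝ} (hA : A.IsSymm)
    (B : Matrix ι α ℝ) : (Bᵀ * A * B).IsHermitian := by
  refine Inertia.isHermitian_of_isSymm ?_
  unfold Matrix.IsSymm at hA ⊢
  rw [Matrix.transpose_mul, Matrix.transpose_mul, Matrix.transpose_transpose, hA, Matrix.mul_assoc]

/-- Images under an injective `B` of an eigenvector sub-family of a hermitian `α × α` matrix are linearly independent. [folklore] -/
theorem linearIndependent_mulVec_eigen {ι α : Type} [Fintype α] [DecidableEq α] (B : Matrix ι α ℝ)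
    (hB : Function.Injective B.mulVec) {C : Matrix α α ℝ} (hC : C.IsHermitian) (p : α → Prop) :
    LinearIndependent ℝ (fun j : {j // p j} => B *ᵥ (hC.eigenvectorBasis j.1).ofLp) := by
  have hli := Inertia.linearIndependent_subtype_eigen hC p
  have hker : LinearMap.ker (Matrix.mulVecLin B) = ⊥ := LinearMap.ker_eq_bot.2 hB
  exact hli.map' (Matrix.mulVecLin B) hker

end Compressions

section MonotoneFlag

variable {ι κ : Type} [Fintype ι] [DecidableEq ι] [Fintype κ] [DecidableEq κ]

/-! ## §2 The two uniform inertia inequalities -/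

/-- **Lower end, for every non-singular `x > 0`: `card α ≤ ν(F(x)) + π(C_U)`.**  The images of the non-positive eigenvectors of the
compression `C_U = B_Uᵀ S₀ B_U` carry `F(x) ⪯ 0` (upper letters vanish on them, lower letters are NSD, the pivot is `≤ 0` there).
[folklore] -/
theorem negIndex_add_posIndex_compression_ge (d : κ → ℕ) (S : κ → Matrix ι ι ℝ) (hS : ∀ l, (S l).IsSymm) (l₀ : κ)
    (hmono : ∀ l, l ≠ l₀ → ((S l).PosSemidef ∧ d l₀ < d l) ∨ ((-(S l)).PosSemidef ∧ d l < d l₀))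
    {α : Type} [Fintype α] [DecidableEq α] (BU : Matrix ι α ℝ) (hBU : ∀ l, d l₀ < d l → S l * BU = 0)
    (hBUi : Function.Injective BU.mulVec) (hCU : (BUᵀ * S l₀ * BU).IsHermitian) {x : ℝ} (hx : 0 < x)
    (hdet : (∑ l, x ^ d l • S l).det ≠ 0) :
    Fintype.card α ≤ Fintype.card {j // (Inertia.isHermitian_pencil d S hS x).eigenvalues j < 0}
      + Fintype.card {j // 0 < hCU.eigenvalues j} := by
  classical
  set hF := Inertia.isHermitian_pencil d S hS x
  -- the non-positive family of the compression, pushed forward by `BU`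
  set w : {j // hCU.eigenvalues j ≤ 0} → ι → ℝ := fun j => BU *ᵥ (hCU.eigenvectorBasis j.1).ofLp with hw
  have hwli : LinearIndependent ℝ w := linearIndependent_mulVec_eigen BU hBUi hCU _
  have hw0 : ∀ c : {j // hCU.eigenvalues j ≤ 0} → ℝ,
      (∑ j, c j • w j) ⬝ᵥ ((∑ l, x ^ d l • S l) *ᵥ ∑ j, c j • w j) ≤ 0 := by
    intro c
    set y : α → ℝ := ∑ j, c j • (hCU.eigenvectorBasis j.1).ofLp with hy
    have hcomb : ∑ j, c j • w j = BU *ᵥ y := by rw [hy]; exact sum_smul_mulVec BU _ c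
    rw [hcomb, Matrix.sum_mulVec, dotProduct_sum]
    refine Finset.sum_nonpos fun l _ => ?_
    rw [Matrix.smul_mulVec, dotProduct_smul, smul_eq_mul]
    refine mul_nonpos_of_nonneg_of_nonpos (pow_pos hx _).le ?_
    by_cases hl : l = l₀
    · subst hl
      rw [form_mulVec_eq, hy]
      exact Inertia.nonpos_eigenFamily hCU c
    rcases hmono l hl with ⟨_, hdl⟩ | ⟨hnsd, _⟩
    · rw [Matrix.mulVec_mulVec, hBU l hdl, Matrix.zero_mulVec, dotProduct_zero]
    · have h := hnsd.dotProduct_mulVec_nonneg (BU *ᵥ y)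
      simp only [star_trivial, Matrix.neg_mulVec, dotProduct_neg] at h
      linarith
  have hcount := Inertia.card_add_card_le' (∑ l, x ^ d l • S l) _ w (Inertia.pos_eigenFamily hF) hwli hw0
  have hidx := (Inertia.negIndex_add_posIndex_add_corank hF).1
  have hcork := Inertia.corank_eq_zero_of_det_ne_zero hdet
  have hnonpos := Inertia.card_nonpos_eigs hCU
  have hle : Fintype.card {j // 0 < hCU.eigenvalues j} ≤ Fintype.card α := Fintype.card_subtype_le _
  rw [hnonpos] at hcount
  omega

/-- **Upper end, for every `x > 0`: `ν(F(x)) + card β ≤ card ι + ν(C_L)`.**  The images of the non-negative eigenvectors of the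
compression `C_L = B_Lᵀ S₀ B_L` carry `F(x) ⪰ 0` (lower letters vanish on them, upper letters are PSD, the pivot is `≥ 0` there).
[folklore] -/
theorem negIndex_add_card_le_compression (d : κ → ℕ) (S : κ → Matrix ι ι ℝ) (hS : ∀ l, (S l).IsSymm) (l₀ : κ)
    (hmono : ∀ l, l ≠ l₀ → ((S l).PosSemidef ∧ d l₀ < d l) ∨ ((-(S l)).PosSemidef ∧ d l < d l₀))
    {β : Type} [Fintype β] [DecidableEq β] (BL : Matrix ι β ℝ) (hBL : ∀ l, d l < d l₀ → S l * BL = 0)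
    (hBLi : Function.Injective BL.mulVec) (hCL : (BLᵀ * S l₀ * BL).IsHermitian) {x : ℝ} (hx : 0 < x) :
    Fintype.card {j // (Inertia.isHermitian_pencil d S hS x).eigenvalues j < 0} + Fintype.card β
      ≤ Fintype.card ι + Fintype.card {j // hCL.eigenvalues j < 0} := by
  classical
  set hF := Inertia.isHermitian_pencil d S hS x
  set w : {j // 0 ≤ hCL.eigenvalues j} → ι → ℝ := fun j => BL *ᵥ (hCL.eigenvectorBasis j.1).ofLp with hw
  have hwli : LinearIndependent ℝ w := linearIndependent_mulVec_eigen BL hBLi hCL _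
  have hw0 : ∀ c : {j // 0 ≤ hCL.eigenvalues j} → ℝ,
      0 ≤ (∑ j, c j • w j) ⬝ᵥ ((∑ l, x ^ d l • S l) *ᵥ ∑ j, c j • w j) := by
    intro c
    set y : β → ℝ := ∑ j, c j • (hCL.eigenvectorBasis j.1).ofLp with hy
    have hcomb : ∑ j, c j • w j = BL *ᵥ y := by rw [hy]; exact sum_smul_mulVec BL _ c
    rw [hcomb, Matrix.sum_mulVec, dotProduct_sum]
    refine Finset.sum_nonneg fun l _ => ?_
    rw [Matrix.smul_mulVec, dotProduct_smul, smul_eq_mul]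
    refine mul_nonneg (pow_pos hx _).le ?_
    by_cases hl : l = l₀
    · subst hl
      rw [form_mulVec_eq, hy]
      exact Inertia.nonneg_eigenFamily hCL c
    rcases hmono l hl with ⟨hpsd, _⟩ | ⟨_, hdl⟩
    · simpa only [star_trivial] using hpsd.dotProduct_mulVec_nonneg (BL *ᵥ y)
    · rw [Matrix.mulVec_mulVec, hBL l hdl, Matrix.zero_mulVec, dotProduct_zero]
  have hcount := Inertia.card_add_card_le (∑ l, x ^ d l • S l) _ w (Inertia.neg_eigenFamily hF) hwli hw0
  have hnonneg := Inertia.card_nonneg_eigs hCL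
  have hle : Fintype.card {j // hCL.eigenvalues j < 0} ≤ Fintype.card β := Fintype.card_subtype_le _
  rw [hnonneg] at hcount
  omega

/-! ## §3 The flag bound -/

/-- **THE FLAG BOUND.**  Monotone sector, pivot letter arbitrary, `det F ≢ 0`; `B_U`, `B_L` injective with columns killed by every
upper, resp. lower, letter; `C_U = B_Uᵀ S₀ B_U`, `C_L = B_Lᵀ S₀ B_L`.  Then the positive roots of `det F` counted WITH MULTIPLICITY
satisfy `Z₊ + card α + card β ≤ card ι + ν(C_L) + π(C_U)`. [folklore] -/
theorem monotone_pencil_flag_bound (d : κ → ℕ) (S : κ → Matrix ι ι ℝ) (hS : ∀ l, (S l).IsSymm) (l₀ : κ)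
    (hmono : ∀ l, l ≠ l₀ → ((S l).PosSemidef ∧ d l₀ < d l) ∨ ((-(S l)).PosSemidef ∧ d l < d l₀))
    (hdet : Matrix.det (∑ l, ((Polynomial.X : Polynomial ℝ) ^ d l) • (S l).map Polynomial.C) ≠ 0)
    {α β : Type} [Fintype α] [DecidableEq α] [Fintype β] [DecidableEq β]
    (BU : Matrix ι α ℝ) (hBU : ∀ l, d l₀ < d l → S l * BU = 0) (hBUi : Function.Injective BU.mulVec)
    (BL : Matrix ι β ℝ) (hBL : ∀ l, d l < d l₀ → S l * BL = 0) (hBLi : Function.Injective BL.mulVec)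
    (hCU : (BUᵀ * S l₀ * BU).IsHermitian) (hCL : (BLᵀ * S l₀ * BL).IsHermitian) :
    Multiset.card ((Matrix.det (∑ l, ((Polynomial.X : Polynomial ℝ) ^ d l) • (S l).map Polynomial.C)).roots.filter
        (fun t => 0 < t)) + Fintype.card α + Fintype.card β
      ≤ Fintype.card ι + Fintype.card {j // hCL.eigenvalues j < 0} + Fintype.card {j // 0 < hCU.eigenvalues j} := by
  classical
  set P := Matrix.det (∑ l, ((Polynomial.X : Polynomial ℝ) ^ d l) • (S l).map Polynomial.C) with hPdef
  -- scales: `b` above every root, `a` below every positive root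
  set b : ℝ := 2 + (P.roots.toFinset.sum fun t => |t|) with hbdef
  set a : ℝ := (1 + ((P.roots.toFinset.filter (fun t => 0 < t)).sum fun t => t⁻¹))⁻¹ with hadef
  have hsumnn : 0 ≤ P.roots.toFinset.sum fun t => |t| := Finset.sum_nonneg fun t _ => abs_nonneg t
  have hsum'nn : 0 ≤ (P.roots.toFinset.filter (fun t => 0 < t)).sum fun t => t⁻¹ :=
    Finset.sum_nonneg fun t ht => (inv_pos.2 (Finset.mem_filter.1 ht).2).le
  have hb1 : 2 ≤ b := by rw [hbdef]; linarith
  have hbpos : 0 < b := by linarith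
  have hapos : 0 < a := by rw [hadef]; positivity
  have ha1 : a ≤ 1 := by
    rw [hadef]
    exact inv_le_one_of_one_le₀ (by linarith)
  have hroot_lt_b : ∀ t ∈ P.roots, t < b := by
    intro t ht
    have hmem : t ∈ P.roots.toFinset := Multiset.mem_toFinset.2 ht
    have h1 : |t| ≤ P.roots.toFinset.sum fun t => |t| :=
      Finset.single_le_sum (f := fun t => |t|) (fun t _ => abs_nonneg t) hmem
    have h2 : t ≤ |t| := le_abs_self t
    rw [hbdef]; linarith
  have hroot_gt_a : ∀ t ∈ P.roots, 0 < t → a < t := by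
    intro t ht htpos
    have hmem : t ∈ P.roots.toFinset.filter (fun t => 0 < t) :=
      Finset.mem_filter.2 ⟨Multiset.mem_toFinset.2 ht, htpos⟩
    have h1 : t⁻¹ ≤ (P.roots.toFinset.filter (fun t => 0 < t)).sum fun t => t⁻¹ :=
      Finset.single_le_sum (f := fun t => t⁻¹) (fun s hs => (inv_pos.2 (Finset.mem_filter.1 hs).2).le) hmem
    have h2 : t⁻¹ < 1 + (P.roots.toFinset.filter (fun t => 0 < t)).sum fun t => t⁻¹ := by linarith
    rw [hadef]
    calc (1 + (P.roots.toFinset.filter (fun t => 0 < t)).sum fun t => t⁻¹)⁻¹ < t⁻¹⁻¹ :=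
          inv_strictAnti₀ (inv_pos.2 htpos) h2
      _ = t := inv_inv t
  have hab : a < b := by linarith
  -- non-singularity at `a` and `b`
  have hmem_of_det : ∀ s : ℝ, (∑ l, s ^ d l • S l).det = 0 → s ∈ P.roots := by
    intro s h0
    rw [Polynomial.mem_roots hdet, Polynomial.IsRoot.def, hPdef, DefiniteMoments.eval_det_pencil]
    exact h0
  have ha : (∑ l, a ^ d l • S l).det ≠ 0 := fun h0 =>
    lt_irrefl a (hroot_gt_a a (hmem_of_det a h0) hapos)
  have hb : (∑ l, b ^ d l • S l).det ≠ 0 := fun h0 =>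
    lt_irrefl b (hroot_lt_b b (hmem_of_det b h0))
  -- the window law on `(a, b)`
  have hwin := monotone_pencil_card_posRoots_multiset_eq_window d S hS l₀ hmono hapos hab ha hb
    (fun t ht htpos => ⟨hroot_gt_a t ht htpos, hroot_lt_b t ht⟩)
  rw [← hPdef] at hwin
  -- the two uniform inequalities at the two scales
  have hlow := negIndex_add_posIndex_compression_ge d S hS l₀ hmono BU hBU hBUi hCU hbpos hb
  have hup := negIndex_add_card_le_compression d S hS l₀ hmono BL hBL hBLi hCL hapos
  omega

/-- **The flag bound, distinct roots.** [folklore] -/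
theorem monotone_pencil_flag_bound_card (d : κ → ℕ) (S : κ → Matrix ι ι ℝ) (hS : ∀ l, (S l).IsSymm) (l₀ : κ)
    (hmono : ∀ l, l ≠ l₀ → ((S l).PosSemidef ∧ d l₀ < d l) ∨ ((-(S l)).PosSemidef ∧ d l < d l₀))
    (hdet : Matrix.det (∑ l, ((Polynomial.X : Polynomial ℝ) ^ d l) • (S l).map Polynomial.C) ≠ 0)
    {α β : Type} [Fintype α] [DecidableEq α] [Fintype β] [DecidableEq β]
    (BU : Matrix ι α ℝ) (hBU : ∀ l, d l₀ < d l → S l * BU = 0) (hBUi : Function.Injective BU.mulVec)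
    (BL : Matrix ι β ℝ) (hBL : ∀ l, d l < d l₀ → S l * BL = 0) (hBLi : Function.Injective BL.mulVec)
    (hCU : (BUᵀ * S l₀ * BU).IsHermitian) (hCL : (BLᵀ * S l₀ * BL).IsHermitian) :
    ((Matrix.det (∑ l, ((Polynomial.X : Polynomial ℝ) ^ d l) • (S l).map Polynomial.C)).roots.toFinset.filter
        (fun t => 0 < t)).card + Fintype.card α + Fintype.card β
      ≤ Fintype.card ι + Fintype.card {j // hCL.eigenvalues j < 0} + Fintype.card {j // 0 < hCU.eigenvalues j} := by
  classical
  have h := monotone_pencil_flag_bound d S hS l₀ hmono hdet BU hBU hBUi BL hBL hBLi hCU hCL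
  have h2 : ((Matrix.det (∑ l, ((Polynomial.X : Polynomial ℝ) ^ d l) • (S l).map Polynomial.C)).roots.toFinset.filter
        (fun t => 0 < t)).card
      ≤ Multiset.card ((Matrix.det (∑ l, ((Polynomial.X : Polynomial ℝ) ^ d l) • (S l).map Polynomial.C)).roots.filter
        (fun t => 0 < t)) := by
    rw [← Multiset.toFinset_filter]
    exact Multiset.toFinset_card_le _
  omega

/-- **One-sided form** (no lower letters, `B_L = 1`): PSD letters above an ARBITRARY pivot letter `S₀`, `det F ≢ 0`, `B_U` injective
with columns in the joint kernel of the upper letters ⇒ `Z₊(mult) + card α ≤ ν(S₀) + π(B_Uᵀ S₀ B_U)`.  (With `card α = 0` this is the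
one-sided rung `Z₊ ≤ ν(S₀)`; no non-singularity hypothesis on any letter.) [folklore] -/
theorem monotone_pencil_flag_bound_oneSided (d : κ → ℕ) (S : κ → Matrix ι ι ℝ) (hS : ∀ l, (S l).IsSymm) (l₀ : κ)
    (hup : ∀ l, l ≠ l₀ → (S l).PosSemidef ∧ d l₀ < d l)
    (hdet : Matrix.det (∑ l, ((Polynomial.X : Polynomial ℝ) ^ d l) • (S l).map Polynomial.C) ≠ 0)
    {α : Type} [Fintype α] [DecidableEq α]
    (BU : Matrix ι α ℝ) (hBU : ∀ l, d l₀ < d l → S l * BU = 0) (hBUi : Function.Injective BU.mulVec)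
    (hCU : (BUᵀ * S l₀ * BU).IsHermitian) (h₀ : (S l₀).IsHermitian) :
    Multiset.card ((Matrix.det (∑ l, ((Polynomial.X : Polynomial ℝ) ^ d l) • (S l).map Polynomial.C)).roots.filter
        (fun t => 0 < t)) + Fintype.card α
      ≤ Fintype.card {j // h₀.eigenvalues j < 0} + Fintype.card {j // 0 < hCU.eigenvalues j} := by
  classical
  have hmono : ∀ l, l ≠ l₀ → ((S l).PosSemidef ∧ d l₀ < d l) ∨ ((-(S l)).PosSemidef ∧ d l < d l₀) :=
    fun l hl => Or.inl (hup l hl)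
  have hBL : ∀ l, d l < d l₀ → S l * (1 : Matrix ι ι ℝ) = 0 := by
    intro l hdl
    by_cases hl : l = l₀
    · subst hl; exact absurd hdl (lt_irrefl _)
    · exact absurd (hup l hl).2 (not_lt.2 hdl.le)
  have hBLi : Function.Injective (1 : Matrix ι ι ℝ).mulVec := fun u v h => by simpa using h
  have hCL : ((1 : Matrix ι ι ℝ)ᵀ * S l₀ * 1).IsHermitian := by
    rw [Matrix.transpose_one, Matrix.one_mul, Matrix.mul_one]; exact h₀
  have h := monotone_pencil_flag_bound d S hS l₀ hmono hdet BU hBU hBUi 1 hBL hBLi hCU hCL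
  have hν : Fintype.card {j // hCL.eigenvalues j < 0} = Fintype.card {j // h₀.eigenvalues j < 0} :=
    Inertia.negIndex_congr hCL h₀ (by rw [Matrix.transpose_one, Matrix.one_mul, Matrix.mul_one])
  rw [hν] at h
  omega

end MonotoneFlag

end GramDual

end Summit.ValiantsHypothesis.ValiantsHypothesis.Theorems.LacunarySymmetroidMatrixDescartes
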